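import Mathlib.MeasureTheory.Constructions.Pi
import Mathlib.MeasureTheory.Integral.Prod
import Mathlib.MeasureTheory.Integral.Bochner.Set
import Mathlib.MeasureTheory.Function.LocallyIntegrable
import HarnessLib

/-!
# Bochner integrals over `Measure.pi`: the `Option ι` Fubini step, the empty base, and index ∕ factorwise transport

Topic `MeasureTheory/Constructions`; namespace `Literature.MeasureTheory.Constructions`.  THEOREMS ONLY (no definition, no instance, no notation,
no named fact, no `sorry`); GENERIC (Mathlib-only).  Cell `pub/hodgecm-mathlib`, line LH10 free hand LH10-p02 (g6) for LH10-p01 (g4)'s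
(α4-S6) «multi-wall Casimir» engine (its `Fintype.induction_empty_option` over the wall places), lane `--supports stmt-HodgeConjecture-24833`;
it pays no printed statement.  HONEST LABEL: HC_CM is proved only modulo the 7 printed citations (2 remaining: hLiu418 = stmt-HodgeConjecture-24832,
h413 = stmt-HodgeConjecture-24833) until rung 0 closes.

THE MATHEMATICS.  For a finite index type `ι`, measurable spaces `β o` (`o : Option ι`) and σ-finite measures `ν o`, Mathlib's
`MeasureTheory.Measure.pi_map_piOptionEquivProd` says that the measurable equivalence
`e := MeasurableEquiv.piOptionEquivProd β : (∀ o, β o) ≃ᵐ (∀ i, β (some i)) × β none` carries `Measure.pi ν` to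
`(Measure.pi fun i => ν (some i)).prod (ν none)`.  Everything here is read off that identity, in the LITERAL `e`-spelling
(`e h = (fun i => h (some i), h none)`, `(e.symm (y, x₀)) (some i) = y i`, `(e.symm (y, x₀)) none = x₀`, all `rfl`):

* §0 `piOptionEquivProd_apply`, `piOptionEquivProd_symm_apply_some ∕ _none`, `continuous_piOptionEquivProd(_symm)` — coordinates and continuity of `e`.
* §1 `measurePreserving_piOptionEquivProd(_symm)` — `e` and `e.symm` are measure preserving.
* §2 (W1) OPTION-FUBINI for Bochner integrals with values in a real normed space `E` (no measurability structure on `E`):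
  `integral_pi_option_eq_integral_prod` (hypothesis-free change of variables), `integrable_comp_piOptionEquivProd_symm_iff`,
  `integral_pi_option` (outer variable `none`: `∫ f d(pi ν) = ∫ x₀, ∫ y, f (e.symm (y, x₀)) d(pi (ν ∘ some)) d(ν none)`), its twin
  `integral_pi_option'` (outer variable the `some`-block), and the reversed readings `integral_prod_eq_integral_pi_option`,
  `integral_integral_eq_integral_pi_option`.  Fubini [vanDoorn2021HaarMeasure, Thm. 3] ∕ [Rudin1987, Thm. 8.8] in Mathlib's Bochner form
  (`MeasureTheory.integral_prod`, `integral_prod_symm`).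
* §3 (W1′) SECTIONS of a continuous compactly supported `f`: `hasCompactSupport_piOption_section(')`, `continuous_piOption_section(')`,
  `integrable_piOption_section(')` (both sections), `continuous_integral_piOption_section` (the partial integral over the `some`-block is continuous
  in `x₀`, Mathlib `continuousOn_integral_of_compact_support`).
* §4 (W2) EMPTY BASE `integral_pi_of_isEmpty`: over an empty index `Measure.pi μ` is the Dirac mass at the empty function (Mathlib `Measure.pi_of_empty`),
  so `∫ g d(pi μ) = g isEmptyElim`.
* §5 (W3) INDEX TRANSPORT along `e : ι' ≃ ι` (`integral_pi_comp_piCongrLeft`, `integrable_comp_piCongrLeft_iff`; Mathlib `measurePreserving_piCongrLeft`).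
* §6 (W4) FACTORWISE TRANSPORT along measure-preserving measurable equivalences `φ i : α i ≃ᵐ γ i` (`measurePreserving_piCongrRight`,
  `integral_pi_comp_piCongrRight`, `integrable_comp_piCongrRight_iff`; Mathlib `measurePreserving_pi`).

What is deliberately NOT here: `lintegral`∕`setIntegral` twins, infinite products, and any `SFinite`-only (non-σ-finite) generality beyond Mathlib's
`Measure.pi` API.

## References
* [vanDoorn2021HaarMeasure] F. van Doorn, *Formalized Haar Measure*, ITP 2021, LIPIcs 193, 18:1–18:17 (arXiv:2102.07636; held as `paper:arxiv-2102.07636`):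
  §4 «Products of Measures», Thm. 3 (Fubini's theorem for the Bochner integral, p. 8 — Mathlib `integral_prod` ∕ `integral_prod_symm`);
  §7 «Concluding Thoughts» (finitary product measures `Measure.pi`, p. 15: «It would be inconvenient to rewrite a finitary product of measures
  into a binary product … and then apply Fubini's theorem for binary product measures» — this file is exactly that rewriting for the index `Option ι`).
* [Rudin1987] W. Rudin, *Real and Complex Analysis*, 3rd ed., McGraw-Hill (1987), Ch. 8 «Integration on product spaces», Thm. 8.8 (the Fubini theorem).
-/

set_option autoImplicit false

noncomputable section

open _root_.MeasureTheory _root_.MeasureTheory.Measure _root_.Topology Set Function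

namespace Literature.MeasureTheory.Constructions

/-! ### §0 Coordinates and continuity of `MeasurableEquiv.piOptionEquivProd` -/

section Coordinates

variable {ι : Type*} {β : Option ι → Type*} [∀ o, MeasurableSpace (β o)]

/-- `e h = (h ∘ some, h none)` for `e = MeasurableEquiv.piOptionEquivProd β` (definitional). [cite: vanDoorn2021HaarMeasure, §7 finitary product measures (p. 15)] -/
@[simp] theorem piOptionEquivProd_apply (h : ∀ o, β o) :
    MeasurableEquiv.piOptionEquivProd β h = (fun i => h (some i), h none) := rfl

/-- `(e.symm (y, x₀)) (some i) = y i` for `e = MeasurableEquiv.piOptionEquivProd β` (definitional). [cite: vanDoorn2021HaarMeasure, §7 finitary product measures (p. 15)] -/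
@[simp] theorem piOptionEquivProd_symm_apply_some (p : (∀ i, β (some i)) × β none) (i : ι) :
    (MeasurableEquiv.piOptionEquivProd β).symm p (some i) = p.1 i := rfl

/-- `(e.symm (y, x₀)) none = x₀` for `e = MeasurableEquiv.piOptionEquivProd β` (definitional). [cite: vanDoorn2021HaarMeasure, §7 finitary product measures (p. 15)] -/
@[simp] theorem piOptionEquivProd_symm_apply_none (p : (∀ i, β (some i)) × β none) :
    (MeasurableEquiv.piOptionEquivProd β).symm p none = p.2 := rfl

/-- `e.symm (e h) = h` pointwise, as a `simp` lemma in the coordinate spelling. [cite: vanDoorn2021HaarMeasure, §7 finitary product measures (p. 15)] -/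
theorem piOptionEquivProd_symm_apply_apply (h : ∀ o, β o) :
    (MeasurableEquiv.piOptionEquivProd β).symm (fun i => h (some i), h none) = h :=
  (MeasurableEquiv.piOptionEquivProd β).symm_apply_apply h

variable [∀ o, TopologicalSpace (β o)]

/-- `e = MeasurableEquiv.piOptionEquivProd β` is continuous for the product topologies. [cite: vanDoorn2021HaarMeasure, §7 finitary product measures (p. 15)] -/
theorem continuous_piOptionEquivProd :
    Continuous (MeasurableEquiv.piOptionEquivProd β : (∀ o, β o) → (∀ i, β (some i)) × β none) :=
  Continuous.prodMk (continuous_pi fun i => continuous_apply (some i)) (continuous_apply none)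

/-- `e.symm` is continuous for the product topologies (`e = MeasurableEquiv.piOptionEquivProd β`). [cite: vanDoorn2021HaarMeasure, §7 finitary product measures (p. 15)] -/
theorem continuous_piOptionEquivProd_symm :
    Continuous ((MeasurableEquiv.piOptionEquivProd β).symm : (∀ i, β (some i)) × β none → ∀ o, β o) := by
  refine continuous_pi fun o => ?_
  cases o with
  | none => exact continuous_snd
  | some i => exact (continuous_apply i).comp continuous_fst

/-- The section map `y ↦ e.symm (y, x₀)` is continuous. [cite: vanDoorn2021HaarMeasure, §7 finitary product measures (p. 15)] -/
theorem continuous_piOptionEquivProd_symm_left (x₀ : β none) :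
    Continuous fun y : ∀ i, β (some i) => (MeasurableEquiv.piOptionEquivProd β).symm (y, x₀) :=
  continuous_piOptionEquivProd_symm.comp (Continuous.prodMk continuous_id continuous_const)

/-- The section map `x₀ ↦ e.symm (y, x₀)` is continuous. [cite: vanDoorn2021HaarMeasure, §7 finitary product measures (p. 15)] -/
theorem continuous_piOptionEquivProd_symm_right (y : ∀ i, β (some i)) :
    Continuous fun x₀ : β none => (MeasurableEquiv.piOptionEquivProd β).symm (y, x₀) :=
  continuous_piOptionEquivProd_symm.comp (Continuous.prodMk continuous_const continuous_id)

end Coordinates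

/-! ### §1 `e` and `e.symm` are measure preserving -/

section MeasurePreserving

variable {ι : Type*} [Fintype ι] {β : Option ι → Type*} [∀ o, MeasurableSpace (β o)]
  (ν : ∀ o, Measure (β o)) [∀ o, SigmaFinite (ν o)]

/-- **`e.symm` IS MEASURE PRESERVING**: `(pi (ν ∘ some)) ⊗ ν none ↦ pi ν` under `e.symm` — Mathlib `Measure.pi_map_piOptionEquivProd` read as a
`MeasurePreserving` statement. [cite: vanDoorn2021HaarMeasure, §7 finitary product measures (p. 15)] -/
theorem measurePreserving_piOptionEquivProd_symm :
    MeasurePreserving (MeasurableEquiv.piOptionEquivProd β).symm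
      ((Measure.pi fun i => ν (some i)).prod (ν none)) (Measure.pi ν) :=
  ⟨(MeasurableEquiv.piOptionEquivProd β).symm.measurable, pi_map_piOptionEquivProd ν⟩

/-- **`e` IS MEASURE PRESERVING**: `pi ν ↦ (pi (ν ∘ some)) ⊗ ν none` under `e = MeasurableEquiv.piOptionEquivProd β`. [cite: vanDoorn2021HaarMeasure, §7 finitary product measures (p. 15)] -/
theorem measurePreserving_piOptionEquivProd :
    MeasurePreserving (MeasurableEquiv.piOptionEquivProd β)
      (Measure.pi ν) ((Measure.pi fun i => ν (some i)).prod (ν none)) := by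
  simpa only [MeasurableEquiv.symm_symm] using
    (measurePreserving_piOptionEquivProd_symm ν).symm (MeasurableEquiv.piOptionEquivProd β).symm

/-- The product measure in the `e`-picture: `Measure.pi ν` pushed forward by `e` is `(pi (ν ∘ some)) ⊗ ν none`. [cite: vanDoorn2021HaarMeasure, §7 finitary product measures (p. 15)] -/
theorem map_piOptionEquivProd_pi :
    (Measure.pi ν).map (MeasurableEquiv.piOptionEquivProd β) = (Measure.pi fun i => ν (some i)).prod (ν none) :=
  (measurePreserving_piOptionEquivProd ν).map_eq

end MeasurePreserving

/-! ### §2 (W1) Option-Fubini for Bochner integrals -/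

section Fubini

variable {ι : Type*} [Fintype ι] {β : Option ι → Type*} [∀ o, MeasurableSpace (β o)]
  (ν : ∀ o, Measure (β o)) [∀ o, SigmaFinite (ν o)]
  {E : Type*} [NormedAddCommGroup E] [NormedSpace ℝ E]

/-- **CHANGE OF VARIABLES** (hypothesis-free): `∫ f d(pi ν) = ∫ p, f (e.symm p) d((pi (ν ∘ some)) ⊗ ν none)`. [cite: vanDoorn2021HaarMeasure, §4 Thm. 3 (p. 8)] [cite: vanDoorn2021HaarMeasure, §7 finitary product measures (p. 15)] -/
theorem integral_pi_option_eq_integral_prod (f : (∀ o, β o) → E) :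
    ∫ x, f x ∂Measure.pi ν =
      ∫ p, f ((MeasurableEquiv.piOptionEquivProd β).symm p) ∂(Measure.pi fun i => ν (some i)).prod (ν none) :=
  ((measurePreserving_piOptionEquivProd_symm ν).integral_comp' f).symm

/-- The reversed reading: `∫ F d((pi (ν ∘ some)) ⊗ ν none) = ∫ h, F (e h) d(pi ν)`. [cite: vanDoorn2021HaarMeasure, §4 Thm. 3 (p. 8)] [cite: vanDoorn2021HaarMeasure, §7 finitary product measures (p. 15)] -/
theorem integral_prod_eq_integral_pi_option (F : (∀ i, β (some i)) × β none → E) :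
    ∫ p, F p ∂(Measure.pi fun i => ν (some i)).prod (ν none) =
      ∫ h, F (MeasurableEquiv.piOptionEquivProd β h) ∂Measure.pi ν :=
  ((measurePreserving_piOptionEquivProd ν).integral_comp' F).symm

omit [NormedSpace ℝ E] in
/-- Integrability transfers along `e.symm`: `f ∘ e.symm` is integrable for `(pi (ν ∘ some)) ⊗ ν none` iff `f` is for `pi ν`. [cite: vanDoorn2021HaarMeasure, §4 Thm. 3 (p. 8)] [cite: vanDoorn2021HaarMeasure, §7 finitary product measures (p. 15)] -/
theorem integrable_comp_piOptionEquivProd_symm_iff (f : (∀ o, β o) → E) :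
    Integrable (fun p => f ((MeasurableEquiv.piOptionEquivProd β).symm p))
        ((Measure.pi fun i => ν (some i)).prod (ν none)) ↔
      Integrable f (Measure.pi ν) :=
  (measurePreserving_piOptionEquivProd_symm ν).integrable_comp_emb
    (MeasurableEquiv.piOptionEquivProd β).symm.measurableEmbedding

omit [NormedSpace ℝ E] in
/-- Integrability transfers along `e`: `F ∘ e` is integrable for `pi ν` iff `F` is for `(pi (ν ∘ some)) ⊗ ν none`. [cite: vanDoorn2021HaarMeasure, §4 Thm. 3 (p. 8)] [cite: vanDoorn2021HaarMeasure, §7 finitary product measures (p. 15)] -/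
theorem integrable_comp_piOptionEquivProd_iff (F : (∀ i, β (some i)) × β none → E) :
    Integrable (fun h => F (MeasurableEquiv.piOptionEquivProd β h)) (Measure.pi ν) ↔
      Integrable F ((Measure.pi fun i => ν (some i)).prod (ν none)) :=
  (measurePreserving_piOptionEquivProd ν).integrable_comp_emb
    (MeasurableEquiv.piOptionEquivProd β).measurableEmbedding

/-- **OPTION-FUBINI, OUTER VARIABLE `none`.**  For `f` integrable against `Measure.pi ν` on `∀ o : Option ι, β o`:
`∫ f d(pi ν) = ∫ x₀, (∫ y, f (e.symm (y, x₀)) d(pi (ν ∘ some))) d(ν none)`. [cite: vanDoorn2021HaarMeasure, §4 Thm. 3 (p. 8)] [cite: Rudin1987, Thm. 8.8] -/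
theorem integral_pi_option (f : (∀ o, β o) → E) (hf : Integrable f (Measure.pi ν)) :
    ∫ x, f x ∂Measure.pi ν =
      ∫ x₀, (∫ y, f ((MeasurableEquiv.piOptionEquivProd β).symm (y, x₀)) ∂Measure.pi fun i => ν (some i)) ∂ν none := by
  rw [integral_pi_option_eq_integral_prod ν f,
    integral_prod_symm _ ((integrable_comp_piOptionEquivProd_symm_iff ν f).2 hf)]

/-- **OPTION-FUBINI, OUTER VARIABLE THE `some`-BLOCK.**  For `f` integrable against `Measure.pi ν`:
`∫ f d(pi ν) = ∫ y, (∫ x₀, f (e.symm (y, x₀)) d(ν none)) d(pi (ν ∘ some))`. [cite: vanDoorn2021HaarMeasure, §4 Thm. 3 (p. 8)] [cite: Rudin1987, Thm. 8.8] -/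
theorem integral_pi_option' (f : (∀ o, β o) → E) (hf : Integrable f (Measure.pi ν)) :
    ∫ x, f x ∂Measure.pi ν =
      ∫ y, (∫ x₀, f ((MeasurableEquiv.piOptionEquivProd β).symm (y, x₀)) ∂ν none) ∂Measure.pi fun i => ν (some i) := by
  rw [integral_pi_option_eq_integral_prod ν f,
    integral_prod _ ((integrable_comp_piOptionEquivProd_symm_iff ν f).2 hf)]

/-- The iterated integral in the other direction: for `F` integrable against `(pi (ν ∘ some)) ⊗ ν none`,
`∫ x₀, ∫ y, F (y, x₀) = ∫ h, F (e h) d(pi ν)`. [cite: vanDoorn2021HaarMeasure, §4 Thm. 3 (p. 8)] [cite: Rudin1987, Thm. 8.8] -/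
theorem integral_integral_eq_integral_pi_option (F : (∀ i, β (some i)) × β none → E)
    (hF : Integrable F ((Measure.pi fun i => ν (some i)).prod (ν none))) :
    ∫ x₀, (∫ y, F (y, x₀) ∂Measure.pi fun i => ν (some i)) ∂ν none =
      ∫ h, F (MeasurableEquiv.piOptionEquivProd β h) ∂Measure.pi ν := by
  rw [← integral_prod_symm F hF]
  exact integral_prod_eq_integral_pi_option ν F

end Fubini

/-! ### §3 (W1′) Sections of a continuous compactly supported integrand -/

section Sections

variable {ι : Type*} {β : Option ι → Type*} [∀ o, MeasurableSpace (β o)] [∀ o, TopologicalSpace (β o)]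
  {E : Type*} [NormedAddCommGroup E]

omit [∀ o, TopologicalSpace (β o)] in
/-- The support of the section `y ↦ f (e.symm (y, x₀))` lies in the `some`-projection of the support of `f`. [cite: vanDoorn2021HaarMeasure, §4 Thm. 3 (p. 8)] [cite: vanDoorn2021HaarMeasure, §7 finitary product measures (p. 15)] -/
theorem support_piOption_section_subset (f : (∀ o, β o) → E) (x₀ : β none) :
    support (fun y : ∀ i, β (some i) => f ((MeasurableEquiv.piOptionEquivProd β).symm (y, x₀))) ⊆
      (fun h : ∀ o, β o => fun i => h (some i)) '' support f := by
  intro y hy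
  exact ⟨(MeasurableEquiv.piOptionEquivProd β).symm (y, x₀), hy, rfl⟩

omit [∀ o, TopologicalSpace (β o)] in
/-- The support of the section `x₀ ↦ f (e.symm (y, x₀))` lies in the `none`-projection of the support of `f`. [cite: vanDoorn2021HaarMeasure, §4 Thm. 3 (p. 8)] [cite: vanDoorn2021HaarMeasure, §7 finitary product measures (p. 15)] -/
theorem support_piOption_section_subset' (f : (∀ o, β o) → E) (y : ∀ i, β (some i)) :
    support (fun x₀ : β none => f ((MeasurableEquiv.piOptionEquivProd β).symm (y, x₀))) ⊆
      (fun h : ∀ o, β o => h none) '' support f := by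
  intro x₀ hx
  exact ⟨(MeasurableEquiv.piOptionEquivProd β).symm (y, x₀), hx, rfl⟩

/-- **SECTIONS ARE COMPACTLY SUPPORTED** (`some`-block variable): if `f` has compact support then so does `y ↦ f (e.symm (y, x₀))`
(its support lies in the continuous image of `tsupport f` under `h ↦ h ∘ some`). [cite: vanDoorn2021HaarMeasure, §4 Thm. 3 (p. 8)] [cite: vanDoorn2021HaarMeasure, §7 finitary product measures (p. 15)] -/
theorem hasCompactSupport_piOption_section [∀ i, R1Space (β (some i))] {f : (∀ o, β o) → E}
    (hcf : HasCompactSupport f) (x₀ : β none) :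
    HasCompactSupport fun y : ∀ i, β (some i) => f ((MeasurableEquiv.piOptionEquivProd β).symm (y, x₀)) := by
  refine HasCompactSupport.of_support_subset_isCompact
    (hcf.image (continuous_pi fun i => continuous_apply (some i))) ?_
  exact (support_piOption_section_subset f x₀).trans (image_mono (subset_tsupport f))

/-- **SECTIONS ARE COMPACTLY SUPPORTED** (`none` variable): if `f` has compact support then so does `x₀ ↦ f (e.symm (y, x₀))`. [cite: vanDoorn2021HaarMeasure, §4 Thm. 3 (p. 8)] [cite: vanDoorn2021HaarMeasure, §7 finitary product measures (p. 15)] -/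
theorem hasCompactSupport_piOption_section' [R1Space (β none)] {f : (∀ o, β o) → E}
    (hcf : HasCompactSupport f) (y : ∀ i, β (some i)) :
    HasCompactSupport fun x₀ : β none => f ((MeasurableEquiv.piOptionEquivProd β).symm (y, x₀)) := by
  refine HasCompactSupport.of_support_subset_isCompact (hcf.image (continuous_apply none)) ?_
  exact (support_piOption_section_subset' f y).trans (image_mono (subset_tsupport f))

/-- Sections of a continuous `f` are continuous (`some`-block variable). [cite: vanDoorn2021HaarMeasure, §4 Thm. 3 (p. 8)] [cite: vanDoorn2021HaarMeasure, §7 finitary product measures (p. 15)] -/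
theorem continuous_piOption_section {f : (∀ o, β o) → E} (hf : Continuous f) (x₀ : β none) :
    Continuous fun y : ∀ i, β (some i) => f ((MeasurableEquiv.piOptionEquivProd β).symm (y, x₀)) :=
  hf.comp (continuous_piOptionEquivProd_symm_left x₀)

/-- Sections of a continuous `f` are continuous (`none` variable). [cite: vanDoorn2021HaarMeasure, §4 Thm. 3 (p. 8)] [cite: vanDoorn2021HaarMeasure, §7 finitary product measures (p. 15)] -/
theorem continuous_piOption_section' {f : (∀ o, β o) → E} (hf : Continuous f) (y : ∀ i, β (some i)) :
    Continuous fun x₀ : β none => f ((MeasurableEquiv.piOptionEquivProd β).symm (y, x₀)) :=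
  hf.comp (continuous_piOptionEquivProd_symm_right y)

/-- **SECTIONS ARE INTEGRABLE** (`some`-block variable): a continuous compactly supported `f` has integrable sections
`y ↦ f (e.symm (y, x₀))` against any measure on `∀ i, β (some i)` that is finite on compacts. [cite: vanDoorn2021HaarMeasure, §4 Thm. 3 (p. 8)] [cite: vanDoorn2021HaarMeasure, §7 finitary product measures (p. 15)] -/
theorem integrable_piOption_section [OpensMeasurableSpace (∀ i, β (some i))] [∀ i, R1Space (β (some i))]
    (μ : Measure (∀ i, β (some i))) [IsFiniteMeasureOnCompacts μ]
    {f : (∀ o, β o) → E} (hf : Continuous f) (hcf : HasCompactSupport f) (x₀ : β none) :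
    Integrable (fun y : ∀ i, β (some i) => f ((MeasurableEquiv.piOptionEquivProd β).symm (y, x₀))) μ :=
  (continuous_piOption_section hf x₀).integrable_of_hasCompactSupport (hasCompactSupport_piOption_section hcf x₀)

/-- **SECTIONS ARE INTEGRABLE** (`none` variable): a continuous compactly supported `f` has integrable sections
`x₀ ↦ f (e.symm (y, x₀))` against any measure on `β none` that is finite on compacts. [cite: vanDoorn2021HaarMeasure, §4 Thm. 3 (p. 8)] [cite: vanDoorn2021HaarMeasure, §7 finitary product measures (p. 15)] -/
theorem integrable_piOption_section' [OpensMeasurableSpace (β none)] [R1Space (β none)]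
    (μ₀ : Measure (β none)) [IsFiniteMeasureOnCompacts μ₀]
    {f : (∀ o, β o) → E} (hf : Continuous f) (hcf : HasCompactSupport f) (y : ∀ i, β (some i)) :
    Integrable (fun x₀ : β none => f ((MeasurableEquiv.piOptionEquivProd β).symm (y, x₀))) μ₀ :=
  (continuous_piOption_section' hf y).integrable_of_hasCompactSupport (hasCompactSupport_piOption_section' hcf y)

/-- **THE PARTIAL INTEGRAL IS CONTINUOUS.**  For `f` continuous with compact support, `x₀ ↦ ∫ y, f (e.symm (y, x₀)) dμ` is continuous on `β none`
for every measure `μ` on the `some`-block that is finite on compacts (uniform compact support = the `some`-projection of `tsupport f`;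
Mathlib `continuousOn_integral_of_compact_support`). [cite: vanDoorn2021HaarMeasure, §4 Thm. 3 (p. 8)] [cite: vanDoorn2021HaarMeasure, §7 finitary product measures (p. 15)] -/
theorem continuous_integral_piOption_section [NormedSpace ℝ E] [OpensMeasurableSpace (∀ i, β (some i))]
    (μ : Measure (∀ i, β (some i))) [IsFiniteMeasureOnCompacts μ]
    {f : (∀ o, β o) → E} (hf : Continuous f) (hcf : HasCompactSupport f) :
    Continuous fun x₀ : β none =>
      ∫ y, f ((MeasurableEquiv.piOptionEquivProd β).symm (y, x₀)) ∂μ := by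
  rw [← continuousOn_univ]
  refine continuousOn_integral_of_compact_support
    (f := fun (x₀ : β none) (y : ∀ i, β (some i)) => f ((MeasurableEquiv.piOptionEquivProd β).symm (y, x₀)))
    (hcf.image (continuous_pi fun i => continuous_apply (some i))) ?_ ?_
  · exact (hf.comp (continuous_piOptionEquivProd_symm.comp
      (Continuous.prodMk continuous_snd continuous_fst))).continuousOn
  · intro x₀ y _ hy
    by_contra h
    exact hy ⟨(MeasurableEquiv.piOptionEquivProd β).symm (y, x₀), subset_tsupport f h, rfl⟩

end Sections

/-! ### §4 (W2) The empty base -/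

section Empty

variable {ι' : Type*} [Fintype ι'] [IsEmpty ι'] {β' : ι' → Type*} [∀ i, MeasurableSpace (β' i)]
  {E : Type*} [NormedAddCommGroup E] [NormedSpace ℝ E]

/-- **EMPTY BASE.**  Over an empty index type `Measure.pi μ` is the Dirac mass at the empty function (Mathlib `Measure.pi_of_empty`), so
`∫ g d(pi μ) = g isEmptyElim` for EVERY `g` with values in a Banach space (the domain is a one-point type, so `g` is strongly measurable;
completeness of `E` is needed, Mathlib's integral being `0` otherwise). [cite: vanDoorn2021HaarMeasure, §7 finitary product measures (p. 15)] -/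
theorem integral_pi_of_isEmpty [CompleteSpace E] (μ : ∀ i, Measure (β' i)) (g : (∀ i, β' i) → E) :
    ∫ x, g x ∂Measure.pi μ = g (fun i => isEmptyElim i) := by
  rw [Measure.pi_of_empty μ]
  exact integral_dirac' g _
    (stronglyMeasurable_const' fun x y => congrArg g (Subsingleton.elim x y))

omit [NormedSpace ℝ E] in
/-- Over an empty index type every `g` is integrable against `Measure.pi μ`. [cite: vanDoorn2021HaarMeasure, §7 finitary product measures (p. 15)] -/
theorem integrable_pi_of_isEmpty (μ : ∀ i, Measure (β' i)) (g : (∀ i, β' i) → E) :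
    Integrable g (Measure.pi μ) := by
  rw [Measure.pi_of_empty μ]
  exact ⟨(stronglyMeasurable_const' fun x y => congrArg g (Subsingleton.elim x y)).aestronglyMeasurable,
    HasFiniteIntegral.of_finite⟩

end Empty

/-! ### §5 (W3) Index transport along `ι' ≃ ι` -/

section IndexTransport

variable {ι ι' : Type*} [Fintype ι] [Fintype ι'] {β : ι → Type*} [∀ i, MeasurableSpace (β i)]
  (μ : ∀ i, Measure (β i)) [∀ i, SigmaFinite (μ i)]
  {E : Type*} [NormedAddCommGroup E] [NormedSpace ℝ E]

/-- **INDEX TRANSPORT.**  For `e : ι' ≃ ι`: `∫ g d(pi μ) = ∫ y, g (MeasurableEquiv.piCongrLeft β e y) d(pi (μ ∘ e))`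
(Mathlib `measurePreserving_piCongrLeft`). [cite: vanDoorn2021HaarMeasure, §7 finitary product measures (p. 15)] -/
theorem integral_pi_comp_piCongrLeft (e : ι' ≃ ι) (g : (∀ i, β i) → E) :
    ∫ x, g x ∂Measure.pi μ =
      ∫ y, g (MeasurableEquiv.piCongrLeft β e y) ∂Measure.pi fun i' => μ (e i') :=
  ((measurePreserving_piCongrLeft μ e).integral_comp' g).symm

omit [NormedSpace ℝ E] in
/-- Integrability transfers along the index transport `MeasurableEquiv.piCongrLeft β e`. [cite: vanDoorn2021HaarMeasure, §7 finitary product measures (p. 15)] -/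
theorem integrable_comp_piCongrLeft_iff (e : ι' ≃ ι) (g : (∀ i, β i) → E) :
    Integrable (fun y => g (MeasurableEquiv.piCongrLeft β e y)) (Measure.pi fun i' => μ (e i')) ↔
      Integrable g (Measure.pi μ) :=
  (measurePreserving_piCongrLeft μ e).integrable_comp_emb (MeasurableEquiv.piCongrLeft β e).measurableEmbedding

omit [Fintype ι] [Fintype ι'] in
/-- The index transport in coordinates: `(MeasurableEquiv.piCongrLeft β e y) (e i') = y i'`. [cite: vanDoorn2021HaarMeasure, §7 finitary product measures (p. 15)] -/
theorem piCongrLeft_apply_apply (e : ι' ≃ ι) (y : ∀ i', β (e i')) (i' : ι') :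
    MeasurableEquiv.piCongrLeft β e y (e i') = y i' :=
  MeasurableEquiv.piCongrLeft_apply_apply e y i'

end IndexTransport

/-! ### §6 (W4) Factorwise transport along measure-preserving measurable equivalences -/

section FactorTransport

variable {ι : Type*} [Fintype ι] {α γ : ι → Type*} [∀ i, MeasurableSpace (α i)] [∀ i, MeasurableSpace (γ i)]
  (μ : ∀ i, Measure (α i)) (μ' : ∀ i, Measure (γ i)) [∀ i, SigmaFinite (μ' i)]
  {E : Type*} [NormedAddCommGroup E] [NormedSpace ℝ E]

/-- **FACTORWISE TRANSPORT IS MEASURE PRESERVING.**  If every `φ i : α i ≃ᵐ γ i` carries `μ i` to `μ' i`, then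
`MeasurableEquiv.piCongrRight φ = (y ↦ fun i => φ i (y i))` carries `pi μ` to `pi μ'` (Mathlib `measurePreserving_pi`). [cite: vanDoorn2021HaarMeasure, §7 finitary product measures (p. 15)] -/
theorem measurePreserving_piCongrRight (φ : ∀ i, α i ≃ᵐ γ i)
    (hφ : ∀ i, MeasurePreserving (φ i) (μ i) (μ' i)) :
    MeasurePreserving (MeasurableEquiv.piCongrRight φ) (Measure.pi μ) (Measure.pi μ') :=
  measurePreserving_pi μ μ' hφ

/-- **FACTORWISE TRANSPORT OF THE INTEGRAL.**  If every `φ i : α i ≃ᵐ γ i` carries `μ i` to `μ' i`, then for EVERY `g`: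
`∫ g d(pi μ') = ∫ y, g (fun i => φ i (y i)) d(pi μ)`. [cite: vanDoorn2021HaarMeasure, §7 finitary product measures (p. 15)] -/
theorem integral_pi_comp_piCongrRight (φ : ∀ i, α i ≃ᵐ γ i)
    (hφ : ∀ i, MeasurePreserving (φ i) (μ i) (μ' i)) (g : (∀ i, γ i) → E) :
    ∫ x, g x ∂Measure.pi μ' = ∫ y, g (fun i => φ i (y i)) ∂Measure.pi μ :=
  ((measurePreserving_piCongrRight μ μ' φ hφ).integral_comp' g).symm

omit [NormedSpace ℝ E] in
/-- Integrability transfers along the factorwise transport. [cite: vanDoorn2021HaarMeasure, §7 finitary product measures (p. 15)] -/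
theorem integrable_comp_piCongrRight_iff (φ : ∀ i, α i ≃ᵐ γ i)
    (hφ : ∀ i, MeasurePreserving (φ i) (μ i) (μ' i)) (g : (∀ i, γ i) → E) :
    Integrable (fun y => g (fun i => φ i (y i))) (Measure.pi μ) ↔ Integrable g (Measure.pi μ') :=
  (measurePreserving_piCongrRight μ μ' φ hφ).integrable_comp_emb
    (MeasurableEquiv.piCongrRight φ).measurableEmbedding

end FactorTransport

end Literature.MeasureTheory.Constructions

end
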